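import Summits.BirchSwinnertonDyer.BirchSwinnertonDyer.Theorems.AlignedTransportAtTwoMainConjectureOfRankZeroBSDAtTwoHalfDescentLayerIndexGrowthFiniteTwistRelaxed
import Literature.NumberTheory.EllipticCurves.SelmerCorankControlRatLevelZeroProofs
import Literature.NumberTheory.EllipticCurves.QuadraticTwist
import Summits.BirchSwinnertonDyer.Rank1Residual.Additive.StrictSignedSelmerPreimageZero
import HarnessLib

/-!
# Route `AlignedTransportAtTwo`, crux C2 `MainConjectureOfRankZeroBSDAtTwo` (stmt-BirchSwinnertonDyer-22298):
# THE RELAXED GROUP OVER THE BASE IS SUPPORTED ON `{v ∣ p} ∪ {bad v}` — for EVERY number field `K`, prime `p`, `ℤ_p`-extension `κ` and layer `m`,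
# a class of `Sel♯⁽ᵐ⁾_0 = res⁻¹_{K→K_m}(Sel_{p^∞}(E/K_m))` satisfies the HONEST local conditions automatically at the archimedean places and at every finite place
# `v ∤ p` of good reduction; so `Sel♯⁽ᵐ⁾_0 ∩ {honest at v ∣ p and at bad v} = Sel_{p^∞}(E/K)` — the closed form of gen 58's relaxed group at the first layer

HONEST FRAMING (cell `bsd-f1-sign2`, WIDTH-5 attached prover seat `bsd-line-att-p5` gen 59 on line `birth` of the lead `bsd-line-att-p2`;
`--supports` stmt-BirchSwinnertonDyer-22298, closes nothing; BSD is NOT proved by any of this; the crux C2, its verdict «blocked-on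
`Rank1Residual.GreenbergMuConjectureIrreducible`» and every registered stub (P / T / Kμ / LimDoor / MuIneqʳ / PFμ⁺) are untouched). THEOREMS ONLY — no `def`,
no instance, no named fact, no `sorry`. Sequel of `…GrowthFiniteTwistRelaxed` (this gen: the local form of the relaxed condition, the finite-step local kernel inside Greenberg's
local tower kernel `𝒦_{v,n}`, its vanishing at the archimedean and at the split places) and of the tree's PROVED level-`0` case of Greenberg's Lemma 3.3
(`WeierstrassCurve.localTowerKer_zero_eq_bot_of_hasGoodReductionAt`: `𝒦_{v,0} = 0` at every finite `v ∤ p` of good reduction, for EVERY `ℤ_p`-extension).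

THE POINT. At level `0` (`K_0 = K`, `Gal(K̄/K_0) = Γ_K`, conjugation acts trivially) the `K_m`-relaxed condition at a finite place `v` is membership of the localisation in
`ker(H¹(K_v, E) → H¹(K_vK_m, E)) ⊆ 𝒦_{v,0} = ker(H¹(K_v, E) → H¹(K_vK_∞, E))`, and `𝒦_{v,0} = 0` whenever `v ∤ p` has good reduction (Lemma 3.3, PROVED in the tree at `n = 0`:
`B_v = E[p^∞]` is unramified and divisible there). Hence ★★ **a `K_m`-relaxed class over `K` satisfies the honest local condition at every good `v ∤ p`**
(`mem_localKerOver_zero_of_mem_comap_of_hasGoodReductionAt`) and ★★★ **`c ∈ Sel♯⁽ᵐ⁾_0` together with the honest local conditions at the places above `p` and at the places of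
bad reduction forces `c ∈ Sel_{p^∞}(E/K)`** (`mem_selmerLayer_zero_of_mem_comap`; equality form `comap_resOfLe_selmerLayer_zero_inf_eq`). Read with gen 58 (`#M_1(W) = #Sel♯_0(W^{(d)})`,
`K_1 = K(√d)`) and this gen's `…TwistHonest`: the relaxation separating the seed's signed object at the first layer from the honest `2^∞`-Selmer group of the twist `W^{(d)}` over
`K` is carried ENTIRELY by the local conditions of `W^{(d)}` at the places above `2` and at its bad places — Kramer's list of places with `i_v ≠ 0` (Props. 1–6, eq. (11)) in
`2^∞`-currency, with the archimedean contribution absent because a `ℤ₂`-tower is unramified at infinity.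
What is NOT claimed: no local index at `v ∣ p` or at a bad place is computed; nothing numerical about any curve; C2 untouched.
Memo `Cruxes/MainConjectureOfRankZeroBSDAtTwo/RELAXED-PREIMAGE-att-p5-g59.md`.

References: R. Greenberg, LNM 1716 (1999), §3 Lemma 3.3 (p. 86–87), pp. 85–90 [GreenbergLNM1716]; K. Kramer, Trans. AMS 264 (1981), §2 Props. 1–6, Prop. 7, eq. (11) [Kramer1981];
B. Mazur, Invent. Math. 18 (1972), §4 (unramified cohomology / Lang), §6 [Mazur1972]; J.-P. Serre, *Galois Cohomology*, I.§2.6, II.§5 [SerreGaloisCohomology1997];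
J. Silverman, AEC, VII.4, X.2 Prop. 2.4 [SilvermanAEC2009].
-/

set_option linter.dupNamespace false
set_option autoImplicit false

noncomputable section

open scoped Classical

universe u

namespace Summit.BirchSwinnertonDyer.BirchSwinnertonDyer.Theorems.AlignedTransportAtTwoHalfDescentLayerIndexGrowthFiniteTwistRelaxedPlaces

open WeierstrassCurve Literature.NumberTheory.EllipticCurves NumberField IsDedekindDomain
  Summit.BirchSwinnertonDyer.BirchSwinnertonDyer.Theorems.AlignedTransportAtTwoHalfDescentLayerIndexGrowthFiniteTwistRelaxed

section LevelZero

variable {K : Type u} [Field K] [NumberField K] (W : WeierstrassCurve K) {p : ℕ} [hp : Fact p.Prime] (κ : ZpExtension K p)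

/-- ★ **At a finite place `v ∤ p` of good reduction the finite-step local kernel over the BASE vanishes**: `ker(H¹(K_v, E) → H¹(K_vK_m, E)) ≤ 𝒦_{v,0} = 0` (Greenberg's Lemma 3.3 at
level `0`, PROVED in the tree for every `ℤ_p`-extension: `localTowerKer_zero_eq_bot_of_hasGoodReductionAt`). [cite: GreenbergLNM1716, §3 Lemma 3.3] [cite: Mazur1972, §4] -/
theorem ker_resOfLe_local_zero_eq_bot_of_hasGoodReductionAt [W.IsElliptic] (m : ℕ) (v : HeightOneSpectrum (𝓞 K)) (hpv : (p : 𝓞 K) ∉ v.asIdeal)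
    (hgood : W.HasGoodReductionAt v) :
    (Literature.NumberTheory.EllipticCurves.resOfLe (localPoints W (v.adicCompletion K)) (localSubgroup_layer_antitone κ (v.adicCompletion K) (Nat.zero_le m))).ker = ⊥ :=
  le_bot_iff.mp ((ker_resOfLe_local_le_localTowerKer W κ (v.adicCompletion K) (Nat.zero_le m)).trans
    (W.localTowerKer_zero_eq_bot_of_hasGoodReductionAt κ v hpv hgood).le)

/-- ★★ **A `K_m`-relaxed class over `K` satisfies the HONEST local condition at every finite place `v ∤ p` of good reduction** (every conjugate: at level `0` conjugation is trivial anyway).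
[cite: GreenbergLNM1716, §3 Lemma 3.3] [cite: Kramer1981, §2 (i_v = 0 at good odd unramified places)] -/
theorem conjH1_mem_localKerOver_zero_of_mem_comap_of_hasGoodReductionAt [W.IsElliptic] {m : ℕ} {c : W.subgroupH1 p (κ.layerSubgroup 0)}
    (hc : c ∈ (W.selmerLayer κ m).comap (W.resOfLe p (κ.layerSubgroup_antitone (Nat.zero_le m)))) (v : HeightOneSpectrum (𝓞 K)) (hpv : (p : 𝓞 K) ∉ v.asIdeal)
    (hgood : W.HasGoodReductionAt v) (σ : Field.absoluteGaloisGroup K) :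
    W.conjH1 p (κ.layerSubgroup 0) σ c ∈ W.localKerOver p (κ.layerSubgroup 0) (v.adicCompletion K) := by
  have h := ((mem_comap_resOfLe_selmerLayer_iff W κ (Nat.zero_le m) c).mp hc).1 v σ
  rw [ker_resOfLe_local_zero_eq_bot_of_hasGoodReductionAt W κ m v hpv hgood, AddSubgroup.mem_bot] at h
  rw [mem_localKerOver_iff]
  exact h

/-- ★★ The same without conjugates: **`c ∈ Sel♯⁽ᵐ⁾_0` ⟹ `c` satisfies the local condition of `Sel_{p^∞}(E/K)` at every good `v ∤ p`**. [cite: GreenbergLNM1716, §3 Lemma 3.3] -/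
theorem mem_localKerOver_zero_of_mem_comap_of_hasGoodReductionAt [W.IsElliptic] {m : ℕ} {c : W.subgroupH1 p (κ.layerSubgroup 0)}
    (hc : c ∈ (W.selmerLayer κ m).comap (W.resOfLe p (κ.layerSubgroup_antitone (Nat.zero_le m)))) (v : HeightOneSpectrum (𝓞 K)) (hpv : (p : 𝓞 K) ∉ v.asIdeal)
    (hgood : W.HasGoodReductionAt v) : c ∈ W.localKerOver p (κ.layerSubgroup 0) (v.adicCompletion K) := by
  have h := conjH1_mem_localKerOver_zero_of_mem_comap_of_hasGoodReductionAt W κ hc v hpv hgood 1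
  rwa [Rank1Residual.Additive.conjH1_layerSubgroup_zero_apply W κ] at h

/-- ★★★ **THE RELAXED GROUP OVER THE BASE IS SUPPORTED ON `{v ∣ p} ∪ {bad v}`.** If `c ∈ Sel♯⁽ᵐ⁾_0 = res⁻¹_{K→K_m}(Sel_{p^∞}(E/K_m))` satisfies the honest local condition of
`Sel_{p^∞}(E/K)` at every finite place that divides `p` or has bad reduction, then `c ∈ Sel_{p^∞}(E/K)`: the archimedean conditions (`…Relaxed.conjH1_mem_localKerOver_infinitePlace_of_mem_comap`)
and the good places away from `p` (Lemma 3.3 at level `0`) take care of themselves. No hypothesis on `κ`, `p`, or the reduction at `p`. [cite: GreenbergLNM1716, §3 Lemma 3.3, pp. 85–90]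
[cite: Kramer1981, Prop. 7, eq. (11)] -/
theorem mem_selmerLayer_zero_of_mem_comap [W.IsElliptic] {m : ℕ} {c : W.subgroupH1 p (κ.layerSubgroup 0)}
    (hc : c ∈ (W.selmerLayer κ m).comap (W.resOfLe p (κ.layerSubgroup_antitone (Nat.zero_le m))))
    (hS : ∀ v : HeightOneSpectrum (𝓞 K), ((p : 𝓞 K) ∈ v.asIdeal ∨ ¬ W.HasGoodReductionAt v) → c ∈ W.localKerOver p (κ.layerSubgroup 0) (v.adicCompletion K)) :
    c ∈ W.selmerLayer κ 0 := by
  refine mem_selmerLayer_of_mem_comap W κ (Nat.zero_le m) hc fun v ↦ Or.inr fun σ ↦ ?_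
  rw [Rank1Residual.Additive.conjH1_layerSubgroup_zero_apply W κ]
  by_cases hpv : (p : 𝓞 K) ∈ v.asIdeal
  · exact hS v (Or.inl hpv)
  · by_cases hgood : W.HasGoodReductionAt v
    · exact mem_localKerOver_zero_of_mem_comap_of_hasGoodReductionAt W κ hc v hpv hgood
    · exact hS v (Or.inr hgood)

/-- ★★★ Equality form: **`Sel♯⁽ᵐ⁾_0 ⊓ ⨅_{v ∣ p or bad} 𝓛_v = Sel_{p^∞}(E/K)`**, `𝓛_v` the honest local condition at `v` (level `0`, no conjugates needed). The `K_m`-relaxation of the Selmer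
group over the base is invisible outside the places above `p` and the bad places. [cite: GreenbergLNM1716, §3 Lemma 3.3, pp. 85–90] [cite: Kramer1981, Prop. 7, eq. (11)] -/
theorem comap_resOfLe_selmerLayer_zero_inf_eq [W.IsElliptic] (m : ℕ) :
    (W.selmerLayer κ m).comap (W.resOfLe p (κ.layerSubgroup_antitone (Nat.zero_le m))) ⊓
        (⨅ (v : HeightOneSpectrum (𝓞 K)) (_ : (p : 𝓞 K) ∈ v.asIdeal ∨ ¬ W.HasGoodReductionAt v), W.localKerOver p (κ.layerSubgroup 0) (v.adicCompletion K)) =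
      W.selmerLayer κ 0 := by
  ext c
  simp only [AddSubgroup.mem_inf, AddSubgroup.mem_iInf]
  constructor
  · rintro ⟨hc, hS⟩
    exact mem_selmerLayer_zero_of_mem_comap W κ hc hS
  · intro hc
    refine ⟨selmerLayer_le_comap_resOfLe W κ (Nat.zero_le m) hc, fun v _ ↦ ?_⟩
    have h := ((W.mem_selmerGroupOver_iff p (κ.layerSubgroup 0) c).mp hc).1 v 1
    rwa [Rank1Residual.Additive.conjH1_layerSubgroup_zero_apply W κ] at h

/-- ★★ Index form: on the base, **`[Sel♯⁽ᵐ⁾_0 : Sel_{p^∞}(E/K)] ∣ #ker g_0`** (from `…Relaxed`) — recorded next to the support statement: the whole relaxation defect of the first `m` layers is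
a divisor of Greenberg's level-`0` control kernel, itself supported on `{v ∣ p} ∪ {bad v}` (Lemma 3.5). [cite: GreenbergLNM1716, §3 Lemmas 3.3–3.5] -/
theorem relIndex_selmerLayer_zero_comap_dvd_natCard_kerG (m : ℕ) :
    (W.selmerLayer κ 0).relIndex ((W.selmerLayer κ m).comap (W.resOfLe p (κ.layerSubgroup_antitone (Nat.zero_le m)))) ∣ Nat.card (W.KerG κ 0) :=
  relIndex_selmerLayer_comap_dvd_natCard_kerG W κ (Nat.zero_le m)

end LevelZero

/-! ## The quadratic twist over the base (`p = 2`): the relaxed group of gen 58 in closed form -/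

section Twist

variable {K : Type u} [Field K] [NumberField K] (W : WeierstrassCurve K) [W.IsElliptic] (κ : ZpExtension K 2) {d : K}

/-- ★★★ `p = 2`, ANY number field `K`, ANY `ℤ₂`-extension `κ`, `d ≠ 0`: **the `K_1`-relaxed `2^∞`-Selmer group `Sel♯_0(W^{(d)}) = {η ∈ H¹(K, W^{(d)}[2^∞]) : res η ∈ Sel_{2^∞}(W^{(d)}/K_1)}`
(gen 58's reading of the seed's signed object `#ker(N_{K_1/K} | Sel_{2^∞}(W/K_1)) = #Sel♯_0(W^{(d)})`, `K_1 = K(√d)`) coincides with `Sel_{2^∞}(W^{(d)}/K)` on every class satisfying the honest local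
conditions of the TWIST at the places above `2` and at the bad places of the twist** (which include the places dividing `d`). [cite: GreenbergLNM1716, §3 Lemma 3.3] [cite: Kramer1981, Prop. 7, eq. (11)]
[cite: SilvermanAEC2009, X.2 Prop. 2.4] -/
theorem mem_selmerLayer_zero_quadraticTwist_of_mem_comap (hd : d ≠ 0) {c : (W.quadraticTwist d).subgroupH1 2 (κ.layerSubgroup 0)}
    (hc : c ∈ ((W.quadraticTwist d).selmerLayer κ 1).comap ((W.quadraticTwist d).resOfLe 2 (κ.layerSubgroup_antitone (Nat.zero_le 1))))
    (hS : ∀ v : HeightOneSpectrum (𝓞 K), ((2 : 𝓞 K) ∈ v.asIdeal ∨ ¬ (W.quadraticTwist d).HasGoodReductionAt v) →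
      c ∈ (W.quadraticTwist d).localKerOver 2 (κ.layerSubgroup 0) (v.adicCompletion K)) :
    c ∈ (W.quadraticTwist d).selmerLayer κ 0 := by
  haveI := W.isElliptic_quadraticTwist hd
  exact mem_selmerLayer_zero_of_mem_comap (W.quadraticTwist d) κ hc (by exact_mod_cast hS)

end Twist

end Summit.BirchSwinnertonDyer.BirchSwinnertonDyer.Theorems.AlignedTransportAtTwoHalfDescentLayerIndexGrowthFiniteTwistRelaxedPlaces

end
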